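/-
Copyright (c) 2026 the pub-hodgecm-mathlib formalisation cell (harness21).  Prover seat hodgecm-mathlib-LH4-p02 (g12): STAGE 1a «(D-RAM) FOUR-FRAME» squad of
crux H413 (director s1808; heir LEAD F0P3a-plan (g18); dealer LH4-plan (g10); U0 assembler LH4-p01 (g17) 20:41:15Z «`stub_U0_normSurj_oneUnits_wild` → LH4-p02»), 2026-09-03.
-/
import Literature.NumberTheory.LocalFields.WildQuadraticDatumTrace            -- ★ p854561 (LH4-p03 (g11)): `two_ne_zero`, `v_trace_varpi_eq_or`, `v_varpi_pow` (the datum toolkit)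
import Literature.NumberTheory.LocalFields.CompleteValuedSquareRootNearOne    -- ★ `exists_mul_self_eq_of_valued_sub_one_lt_four` (Hensel square roots near `1`)
import Literature.NumberTheory.Automorphic.UnitaryThreeFourFrameDefs          -- ★ p854559 (#0a): `IsRamifiedQuadraticDatum`
import HarnessLib

/-!
# The RAMIFIED QUADRATIC DATUM: NORMS ARE ONTO THE DEEP FIXED ONE-UNITS, SHARPLY — `σu = u`, `|u − 1| ≤ |ϖ|^{2d}` ⇒ `u = zσz` with `|z − 1| ≤ |u − 1|·|ϖ|^{1−d}`
# (Serre, *Local Fields* V §3 Cor. 3: `N(U_E^{ψ(n)}) = U_F^{(n)}`, `ψ(n) = 2n − d + 1` for `n ≥ d`; any residue characteristic)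

Topic `NumberTheory/LocalFields`; namespace `Literature.NumberTheory.LocalFields.WildQuadraticDatum` (the one-field datum of ★ `WildQuadraticDatumTrace`: `σ` an involution of a
discretely valued field `K`, non-zero `σ`-fixed elements of even valuation, `ϖ` a uniformiser, `|ϖ − σϖ| = |ϖ|^d`, `|2| = |ϖ|^t`).  THEOREMS ONLY (no definition, no instance,
no notation, no named fact, no `sorry`); kernel lane.  Cell `pub/hodgecm-mathlib` (D-0151), crux H413 = `stmt-HodgeConjecture-24833`; road «(D-RAM) FOUR-FRAME», unit
U0_WildTree, row `stub_U0_normSurj_oneUnits_wild` (the `hnorm` REPLACEMENT at a wild place: the first-order norm property of the tame files is false at `d ≥ 2`; the right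
statement is Serre's `ψ`).  THE PROOF HAS NO LIMITS AND NO LADDER: (§1) a TRACE-ONE element `θ` (`θ + σθ = 1`) with `|θ|·|ϖ|^d = |ϖ|` exists at every datum — `θ = ϖ∕(ϖ + σϖ)`
when `|ϖ + σϖ| = |ϖ|^d` (ramified-unit type), else `d = t + 1` (ramified-prime ∕ tame, ★ `v_trace_varpi_eq_or`) and `θ = ½`; (§2) for `σ`-FIXED `y` one has
`N(1 + yθ) = 1 + y + c·y²`, `c = θσθ`, so `N(1 + yθ) = 1 + a` is the fixed-field QUADRATIC `cy² + y = a ⟺ (2cy + 1)² = 1 + 4ac`; for `|a| ≤ |ϖ|^{2d}` one has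
`|4ac| ≤ |4|·|ϖ|² < |4|`, so ★ `exists_mul_self_eq_of_valued_sub_one_lt_four` (Hensel, `[IsAdicComplete 𝓂[K] 𝒪[K]]`) gives `r² = 1 + 4ac`, `|r − 1| < |2|`, and `σr = r`
(the other root `−r` is at distance exactly `|2|` from `1`); `y = (r − 1)∕(2c)`, `z = 1 + yθ` has `zσz = 1 + a` and `|z − 1| = |a|·|θ| = |a|·|ϖ|^{1−d}` ON THE NOSE.
HONEST LABEL: HC_CM is proved only modulo the 7 printed citations (2 remaining: hLiu418 = stmt-HodgeConjecture-24832, h413 = stmt-HodgeConjecture-24833) until rung 0 closes; nothing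
printed is asserted here; (D-RAM) `stub_DyRamCore` stays PRINT until the road's END lands.

* §1 **`exists_traceOne_of_datum`** (`∃ θ, θ + σθ = 1 ∧ |θ|·|ϖ|^d = |ϖ|`).  §2 `map_eq_self_of_mul_self_eq` (the Hensel root is `σ`-fixed),
  **`exists_mul_map_eq_of_fixed_of_v_sub_one_le`** (the sharp norm preimage), **`exists_mul_map_eq_of_isRamifiedQuadraticDatum`** (datum form, `[IsAdicComplete 𝓂[K] 𝒪[K]]`).

## References
* [Serre1979] J.-P. Serre, *Local Fields*, GTM 67 (1979): Ch. V §3 Prop. 5 and Cor. 3 (norm groups of a totally ramified cyclic extension of prime degree, the function `ψ`),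
  Ch. III §3 Prop. 7 (trace images), Ch. II §4 Prop. 7 (Hensel).
* [NeukirchANT1999] J. Neukirch, *Algebraic Number Theory* (1999): Ch. V (1.2), Ch. II (4.6).
-/

set_option autoImplicit false

open WithZero
open scoped Valued

namespace Literature.NumberTheory.LocalFields.WildQuadraticDatum

open Literature.NumberTheory.Automorphic.UnitaryThreeFourFrame

variable {K : Type*} [Field K] [Valued K ℤᵐ⁰] {σ : K →+* K} {ϖ : K} {d t : ℕ}

/-! ## §1 A trace-one element of valuation `|ϖ|^{1−d}` -/

/-- **A TRACE-ONE ELEMENT OF THE RIGHT SIZE**: at every ramified quadratic datum there is `θ` with `θ + σθ = 1` and `|θ|·|ϖ|^d = |ϖ|` — `θ = ϖ∕(ϖ + σϖ)` when `|ϖ + σϖ| = |ϖ|^d`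
(ramified-unit), otherwise `d = t + 1` (★ `v_trace_varpi_eq_or`) and `θ = ½` (`|½| = |ϖ|^{−t} = |ϖ|^{1−d}`).  (`Tr 𝒟⁻¹ = 𝒪_F` made explicit.) [cite: Serre1979, Ch. III §3 Prop. 7] -/
theorem exists_traceOne_of_datum (hσ : ∀ x, σ (σ x) = x) (hfix : ∀ x : K, σ x = x → x ≠ 0 → ∃ n : ℤ, Valued.v x = exp (2 * n))
    (hϖ : Valued.v ϖ = exp (-1 : ℤ)) (hd : Valued.v (ϖ - σ ϖ) = Valued.v ϖ ^ d) (ht : Valued.v (2 : K) = Valued.v ϖ ^ t) :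
    ∃ θ : K, θ + σ θ = 1 ∧ Valued.v θ * Valued.v ϖ ^ d = Valued.v ϖ := by
  have hϖ0 : ϖ ≠ 0 := fun h => by rw [h, map_zero] at hϖ; exact (exp_ne_zero hϖ.symm).elim
  have hvϖ0 : Valued.v ϖ ≠ 0 := (Valuation.ne_zero_iff _).2 hϖ0
  have h20 : (2 : K) ≠ 0 := two_ne_zero hϖ ht
  rcases v_trace_varpi_eq_or hσ hfix hϖ hd ht with htr | hdt
  · -- ramified-unit type: `θ = ϖ / (ϖ + σϖ)`
    have htr0 : ϖ + σ ϖ ≠ 0 := fun h => by rw [h, map_zero] at htr; exact pow_ne_zero d hvϖ0 htr.symm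
    refine ⟨ϖ / (ϖ + σ ϖ), ?_, ?_⟩
    · rw [map_div₀, map_add, hσ, add_comm (σ ϖ) ϖ, ← add_div, div_self htr0]
    · rw [map_div₀, ← htr, div_mul_cancel₀ _ ((Valuation.ne_zero_iff _).2 htr0)]
  · -- ramified-prime ∕ tame type: `d = t + 1`, `θ = 1/2`
    refine ⟨1 / 2, ?_, ?_⟩
    · rw [map_div₀, map_one, map_ofNat, ← add_div, one_add_one_eq_two, div_self h20]
    · rw [hdt, pow_succ, map_div₀, map_one, ht, one_div, ← mul_assoc, inv_mul_cancel₀ (pow_ne_zero t hvϖ0), one_mul]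

/-! ## §2 The sharp norm preimage of a deep fixed one-unit -/

/-- **THE HENSEL SQUARE ROOT OF A `σ`-FIXED ELEMENT IS `σ`-FIXED**: if `σ` is an isometric involution, `σs = s`, `r·r = s` and `|r − 1| < |2|`, then `σr = r` —
`σr` is again a root at distance `< |2|` from `1`, and the other root `−r` is at distance exactly `|2|` (`(r − 1) − (−r − 1) = 2r`, `|r| = 1`). [cite: Serre1979, Ch. II §4 Prop. 7] -/
theorem map_eq_self_of_mul_self_eq (hvσ : ∀ a, Valued.v (σ a) = Valued.v a) {s r : K} (hσs : σ s = s) (hr : r * r = s)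
    (hr1 : Valued.v (r - 1) < Valued.v (2 : K)) : σ r = r := by
  have hv2 : Valued.v (2 : K) ≤ 1 := by
    rw [show (2 : K) = 1 + 1 by norm_num]; exact (Valuation.map_add _ _ _).trans (by rw [map_one, max_self])
  have hvr : Valued.v r = 1 := by
    have h : r = 1 + (r - 1) := by ring
    rw [h, Valuation.map_add_eq_of_lt_left _ (by rw [map_one]; exact lt_of_lt_of_le hr1 hv2), map_one]
  have hprod : (σ r - r) * (σ r + r) = 0 := by
    have h : σ r * σ r = r * r := by rw [← map_mul, hr, hσs]
    linear_combination h
  rcases mul_eq_zero.1 hprod with h | h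
  · exact sub_eq_zero.1 h
  · exfalso
    have hσr : σ r = -r := by linear_combination h
    have h1 : Valued.v (σ r - 1) < Valued.v (2 : K) := by
      rw [show σ r - 1 = σ (r - 1) by rw [map_sub, map_one], hvσ]; exact hr1
    rw [hσr] at h1
    have h2 : Valued.v ((r - 1) - (-r - 1)) < Valued.v (2 : K) := lt_of_le_of_lt (Valuation.map_sub _ _ _) (max_lt hr1 h1)
    rw [show (r - 1) - (-r - 1) = 2 * r by ring, map_mul, hvr, mul_one] at h2
    exact lt_irrefl _ h2

/-- **NORMS ARE ONTO THE DEEP FIXED ONE-UNITS, SHARPLY** (`[IsAdicComplete 𝓂[K] 𝒪[K]]`, the binder of ★ `exists_mul_self_eq_of_valued_sub_one_lt_four` and of the ★ wild-quadratic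
layer): at a ramified quadratic datum, every `σ`-fixed `u` with `|u − 1| ≤ |ϖ|^{2d}` is a norm `u = z·σz` with `|z − 1|·|ϖ|^d ≤ |u − 1|·|ϖ|` (i.e. `|z − 1| ≤ |u − 1|·|ϖ|^{1−d}`:
Serre's `ψ(n) = 2n − d + 1`).  `z = 1 + yθ` with `θ` from `exists_traceOne_of_datum`, `c = θσθ`, `y = (r − 1)∕(2c)`, `r² = 1 + 4(u−1)c` the Hensel root near `1`.
[cite: Serre1979, Ch. V §3 Prop. 5, Cor. 3] [cite: NeukirchANT1999, Ch. V (1.2)] -/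
theorem exists_mul_map_eq_of_fixed_of_v_sub_one_le [IsAdicComplete 𝓂[K] 𝒪[K]] (hσ : ∀ x, σ (σ x) = x) (hvσ : ∀ a, Valued.v (σ a) = Valued.v a)
    (hfix : ∀ x : K, σ x = x → x ≠ 0 → ∃ n : ℤ, Valued.v x = exp (2 * n)) (hϖ : Valued.v ϖ = exp (-1 : ℤ)) (hd : Valued.v (ϖ - σ ϖ) = Valued.v ϖ ^ d)
    (ht : Valued.v (2 : K) = Valued.v ϖ ^ t) {u : K} (hσu : σ u = u) (hu : Valued.v (u - 1) ≤ Valued.v ϖ ^ (2 * d)) :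
    ∃ z : K, z * σ z = u ∧ Valued.v (z - 1) * Valued.v ϖ ^ d ≤ Valued.v (u - 1) * Valued.v ϖ := by
  have hϖ0 : ϖ ≠ 0 := fun h => by rw [h, map_zero] at hϖ; exact (exp_ne_zero hϖ.symm).elim
  have hvϖ0 : Valued.v ϖ ≠ 0 := (Valuation.ne_zero_iff _).2 hϖ0
  have hϖ1 : Valued.v ϖ < 1 := by rw [hϖ, ← exp_zero, exp_lt_exp]; omega
  have h20 : (2 : K) ≠ 0 := two_ne_zero hϖ ht
  have hv20 : Valued.v (2 : K) ≠ 0 := (Valuation.ne_zero_iff _).2 h20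
  have h40 : (4 : K) ≠ 0 := by rw [show (4 : K) = 2 * 2 by norm_num]; exact mul_ne_zero h20 h20
  have hσ2 : σ 2 = 2 := map_ofNat σ 2
  have hσ4 : σ 4 = 4 := map_ofNat σ 4
  -- §1: the trace-one element `θ` and `c = θσθ`
  obtain ⟨θ, hθtr, hθv⟩ := exists_traceOne_of_datum hσ hfix hϖ hd ht
  have hθ0 : θ ≠ 0 := fun h => by rw [h, map_zero, zero_add] at hθtr; exact zero_ne_one hθtr
  set c : K := θ * σ θ with hc
  have hσc : σ c = c := by rw [hc, map_mul, hσ, mul_comm]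
  have hc0 : c ≠ 0 := mul_ne_zero hθ0 ((map_ne_zero σ).2 hθ0)
  have hvc : Valued.v c = Valued.v θ * Valued.v θ := by rw [hc, map_mul, hvσ]
  have hvc0 : Valued.v c ≠ 0 := (Valuation.ne_zero_iff _).2 hc0
  -- the fixed datum `a = u − 1` and `s = 1 + 4ac`
  set a : K := u - 1 with ha
  have hσa : σ a = a := by rw [ha, map_sub, hσu, map_one]
  have hvac : Valued.v (a * c) ≤ Valued.v ϖ ^ 2 := by
    -- `|c|·|ϖ|^{2d} = (|θ||ϖ|^d)² = |ϖ|²`, so `|a|·|c| = (|a| ∕ |ϖ|^{2d})·|ϖ|² ≤ |ϖ|²`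
    have h2d : Valued.v ϖ ^ (2 * d) ≠ 0 := pow_ne_zero _ hvϖ0
    have hvc2 : Valued.v c * Valued.v ϖ ^ (2 * d) = Valued.v ϖ ^ 2 := by
      rw [hvc, two_mul, pow_add, mul_mul_mul_comm, hθv, pow_two]
    have hq : Valued.v a / Valued.v ϖ ^ (2 * d) ≤ 1 := div_le_one_of_le₀ hu zero_le
    calc Valued.v (a * c) = Valued.v a * Valued.v c * Valued.v ϖ ^ (2 * d) / Valued.v ϖ ^ (2 * d) := by rw [map_mul, mul_div_cancel_right₀ _ h2d]
      _ = Valued.v a * Valued.v ϖ ^ 2 / Valued.v ϖ ^ (2 * d) := by rw [mul_assoc, hvc2]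
      _ = Valued.v a / Valued.v ϖ ^ (2 * d) * Valued.v ϖ ^ 2 := (div_mul_eq_mul_div _ _ _).symm
      _ ≤ 1 * Valued.v ϖ ^ 2 := mul_le_mul' hq le_rfl
      _ = Valued.v ϖ ^ 2 := one_mul _
  set s : K := 1 + 4 * a * c with hs
  have hσs : σ s = s := by rw [hs, map_add, map_one, map_mul, map_mul, hσ4, hσa, hσc]
  have hs1 : Valued.v (s - 1) < Valued.v (4 : K) := by
    rw [hs, add_sub_cancel_left, mul_assoc, map_mul]
    calc Valued.v (4 : K) * Valued.v (a * c) ≤ Valued.v (4 : K) * Valued.v ϖ ^ 2 := mul_le_mul' le_rfl hvac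
      _ < Valued.v (4 : K) * 1 := by
          exact mul_lt_mul_of_pos_left (pow_lt_one' hϖ1 (by norm_num)) (zero_lt_iff.2 ((Valuation.ne_zero_iff _).2 h40))
      _ = Valued.v (4 : K) := mul_one _
  -- Hensel: the root `r` near `1`, `σ`-fixed
  obtain ⟨r, hrr, hr1⟩ := exists_mul_self_eq_of_valued_sub_one_lt_four s hs1
  have hσr : σ r = r := map_eq_self_of_mul_self_eq hvσ hσs hrr hr1
  -- `y = (r − 1)/(2c)` solves `c y² + y = a`
  set y : K := (r - 1) / (2 * c) with hy
  have hσy : σ y = y := by rw [hy, map_div₀, map_sub, hσr, map_one, map_mul, hσ2, hσc]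
  have hquad : c * (y * y) + y = a := by
    have h1 : 2 * c * y = r - 1 := by rw [hy]; field_simp
    have h2 : (2 * c * y + 1) * (2 * c * y + 1) = 1 + 4 * a * c := by rw [h1, sub_add_cancel, hrr]
    have h3 : 4 * c * (c * (y * y) + y) = 4 * c * a := by linear_combination h2
    exact mul_left_cancel₀ (mul_ne_zero h40 hc0) h3
  -- `z = 1 + yθ`
  refine ⟨1 + y * θ, ?_, ?_⟩
  · have h : (1 + y * θ) * σ (1 + y * θ) = 1 + y * (θ + σ θ) + c * (y * y) := by rw [map_add, map_one, map_mul, hσy, hc]; ring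
    rw [h, hθtr, mul_one, add_assoc, add_comm y, hquad, ha, add_sub_cancel]
  · -- `|z − 1| = |y|·|θ|` and `|y| = |a|`: `(r − 1)(r + 1) = s − 1 = 4ac`, `|r + 1| = |2|`
    have hv2 : Valued.v (2 : K) ≤ 1 := by
      rw [show (2 : K) = 1 + 1 by norm_num]; exact (Valuation.map_add _ _ _).trans (by rw [map_one, max_self])
    have hrp1 : Valued.v (r + 1) = Valued.v (2 : K) := by
      rw [show r + 1 = 2 + (r - 1) by ring]; exact Valuation.map_add_eq_of_lt_left _ hr1
    have hvy : Valued.v y = Valued.v a := by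
      have h1 : Valued.v ((r - 1) * (r + 1)) = Valued.v (4 * a * c) := by
        rw [show (r - 1) * (r + 1) = r * r - 1 by ring, hrr, hs, add_sub_cancel_left]
      rw [map_mul, map_mul, map_mul] at h1
      have h2 : Valued.v y * (Valued.v (2 : K) * Valued.v c) = Valued.v (r - 1) := by
        rw [hy, map_div₀, map_mul, div_mul_cancel₀ _ (mul_ne_zero hv20 hvc0)]
      have h4 : Valued.v (4 : K) = Valued.v (2 : K) * Valued.v (2 : K) := by rw [show (4 : K) = 2 * 2 by norm_num, map_mul]
      have h3 : Valued.v y * (Valued.v (2 : K) * Valued.v c * Valued.v (2 : K)) = Valued.v a * (Valued.v (2 : K) * Valued.v c * Valued.v (2 : K)) :=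
        calc Valued.v y * (Valued.v (2 : K) * Valued.v c * Valued.v (2 : K)) = Valued.v y * (Valued.v (2 : K) * Valued.v c) * Valued.v (r + 1) := by rw [hrp1]; ac_rfl
          _ = Valued.v (r - 1) * Valued.v (r + 1) := by rw [h2]
          _ = Valued.v (4 : K) * Valued.v a * Valued.v c := h1
          _ = Valued.v a * (Valued.v (2 : K) * Valued.v c * Valued.v (2 : K)) := by rw [h4]; ac_rfl
      exact mul_right_cancel₀ (mul_ne_zero (mul_ne_zero hv20 hvc0) hv20) h3
    rw [add_sub_cancel_left, map_mul, hvy, ha, mul_assoc, hθv]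

/-- **DATUM FORM (U0's `stub_U0_normSurj_oneUnits_wild` up to the completeness binder)**: for every `IsRamifiedQuadraticDatum σ ϖ d t` over a field whose valuation ring is
`𝓂`-adically complete, `σu = u ∧ |u − 1| ≤ |ϖ|^{2d} ⇒ ∃ z, zσz = u ∧ |z − 1|·|ϖ|^d ≤ |u − 1|·|ϖ|`.  (The U0 module binds `[CompleteSpace K]`; at a CM place both instances are ★ —
`isAdicComplete_valuedMaximalIdeal_valuedInteger_adicCompletion`.) [cite: Serre1979, Ch. V §3 Cor. 3] -/
theorem exists_mul_map_eq_of_isRamifiedQuadraticDatum {K : Type} [Field K] [Valued K ℤᵐ⁰] [IsAdicComplete 𝓂[K] 𝒪[K]] (σ : K →+* K) (ϖ : K) (d t : ℕ)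
    (hD : IsRamifiedQuadraticDatum σ ϖ d t) (u : K) (hσu : σ u = u) (hu : Valued.v (u - 1) ≤ Valued.v ϖ ^ (2 * d)) :
    ∃ z : K, z * σ z = u ∧ Valued.v (z - 1) * Valued.v ϖ ^ d ≤ Valued.v (u - 1) * Valued.v ϖ := by
  obtain ⟨hσ, hvσ, hϖ, heven, hd, -, h2t⟩ := hD
  exact exists_mul_map_eq_of_fixed_of_v_sub_one_le hσ hvσ heven hϖ hd h2t hσu hu

end Literature.NumberTheory.LocalFields.WildQuadraticDatum
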